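import Summits.HubbardSuperconductivity.HubbardSuperconductivity.Theorems.BcsKacWindowShellMultiplicityBoundCyclotomicDegree

/-!
# Route `BcsKacWindow`, crux `ShellMultiplicityBound` (item `stmt-HubbardSuperconductivity-1325`):
# Mann's theorem on minimal vanishing sums of roots of unity (helper file 2/3)

**Mann's theorem** (H. B. Mann, *On linear relations between roots of unity*, Mathematika 12 (1965)
107–117, Thm 1; cf. J. H. Conway, A. J. Jones, Acta Arith. 30 (1976) 229–240, Thm 1). Let
`∑_{i ∈ S} ε_i t_i = 0` be a vanishing `ℚ`-linear combination of complex roots of unity `t_i` with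
all `ε_i ≠ 0`, which is *minimal* (no nonempty proper subsum vanishes). Then every ratio
`t_i / t_j` is a root of unity of order dividing the primorial `∏_{p ≤ |S|} p` (`mann`).

Proof (Mann): normalise `w_i = t_i / t_{i₀}` and let `n` be the least positive integer with all
`w_i ^ n = 1`; write `w_i = ζ^{e_i}` for `ζ = exp(2πi/n)`. For a prime `p ∣ n`, `n = p n₁`, group
the terms into classes according to the residue of the exponent that multiplies the "new" `p`-part:
* if `p ∣ n₁`, classes `e_i mod p`; the class sums `C_j ∈ ℚ(ζ^p)` satisfy `∑_{j<p} ζ^j C_j = 0`, so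
  all `C_j = 0` (`sum_pow_mul_eq_zero_of_dvd`, `[ℚ(ζ):ℚ(ζ^p)] = p`);
* if `p ∤ n₁`, classes `e_i B mod p` where `ζ = ρ^B η^A` (`ρ = ζ^{n₁}`, `η = ζ^p`); the class sums
  satisfy `∑_{j<p} ρ^j C_j = 0`, so they are all equal (`sum_pow_mul_eq_zero_of_not_dvd`), and if
  `p > |S|` some class is empty, so again all `C_j = 0`.
In either case every class is itself a vanishing subsum, so by minimality there is only one class,
the class of `i₀` (exponent `0`); then all `e_i ≡ 0 mod p`, all `w_i ∈ μ_{n₁}`, contradicting the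
minimality of `n`. Hence `n` is squarefree with all prime factors `≤ |S|`, i.e. `n ∣ primorial |S|`.

Also proved here: every index of a vanishing sum lies in a minimal vanishing sub-block
(`exists_minimal_vanishing_block`), and the packaged consequence used by the shell count
(`exists_block_ratio_pow_primorial_eq_one`).
-/

set_option linter.dupNamespace false

namespace Summit.HubbardSuperconductivity.HubbardSuperconductivity.Theorems.BcsKacWindow

open Module IntermediateField Polynomial Finset

/-! ### Minimal vanishing blocks -/

/-- Every index of a finite vanishing sum lies in a *minimal* vanishing sub-block (a nonempty
sub-block with vanishing sum none of whose nonempty proper sub-blocks vanishes): peel off a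
vanishing sub-block of least cardinality and induct on the rest. -/
theorem exists_minimal_vanishing_block {ι : Type*} [DecidableEq ι] (f : ι → ℂ) (S : Finset ι)
    (hS : ∑ i ∈ S, f i = 0) {i : ι} (hi : i ∈ S) :
    ∃ B ⊆ S, i ∈ B ∧ ∑ k ∈ B, f k = 0 ∧
      ∀ C ⊆ B, C.Nonempty → C ≠ B → ∑ k ∈ C, f k ≠ 0 := by
  induction S using Finset.strongInduction with
  | H S ih =>
    set P : Finset (Finset ι) := S.powerset.filter (fun B => B.Nonempty ∧ ∑ k ∈ B, f k = 0)
      with hP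
    have hSP : S ∈ P := by
      rw [hP, mem_filter, mem_powerset]
      exact ⟨subset_rfl, ⟨i, hi⟩, hS⟩
    obtain ⟨B₀, hB₀P, hB₀min⟩ := P.exists_min_image Finset.card ⟨S, hSP⟩
    rw [hP, mem_filter, mem_powerset] at hB₀P
    obtain ⟨hB₀S, hB₀ne, hB₀sum⟩ := hB₀P
    -- `B₀` is a minimal vanishing block
    have hB₀minimal : ∀ C ⊆ B₀, C.Nonempty → C ≠ B₀ → ∑ k ∈ C, f k ≠ 0 := by
      intro C hCB hCne hCneq hC0
      have hCP : C ∈ P := by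
        rw [hP, mem_filter, mem_powerset]
        exact ⟨hCB.trans hB₀S, hCne, hC0⟩
      have h1 := hB₀min C hCP
      have h2 : C.card < B₀.card := card_lt_card (hCB.ssubset_of_ne hCneq)
      omega
    by_cases hiB : i ∈ B₀
    · exact ⟨B₀, hB₀S, hiB, hB₀sum, hB₀minimal⟩
    · have hssub : S \ B₀ ⊂ S := sdiff_ssubset hB₀S hB₀ne
      have hvan : ∑ k ∈ S \ B₀, f k = 0 := by
        have := sum_sdiff hB₀S (f := f)
        rw [hB₀sum, add_zero, hS] at this
        exact this
      obtain ⟨B, hBS, hiB', hBsum, hBmin⟩ := ih (S \ B₀) hssub hvan (mem_sdiff.mpr ⟨hi, hiB⟩)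
      exact ⟨B, hBS.trans sdiff_subset, hiB', hBsum, hBmin⟩

/-! ### Mann's theorem -/

section Mann

variable {ι : Type*} [DecidableEq ι]

/-- One class of a minimal relation: if the sub-block `S.filter (cl · = 0)` of a minimal vanishing
sum vanishes and contains `i₀`, it is everything. -/
theorem filter_eq_self_of_minimal (S : Finset ι) (g : ι → ℂ) (cl : ι → ℕ)
    (hmin : ∀ T ⊆ S, T.Nonempty → T ≠ S → ∑ i ∈ T, g i ≠ 0)
    (hvan : ∑ i ∈ S.filter (fun i => cl i = 0), g i = 0) {i₀ : ι} (hi₀ : i₀ ∈ S)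
    (hcl₀ : cl i₀ = 0) : ∀ i ∈ S, cl i = 0 := by
  have hT : S.filter (fun i => cl i = 0) = S := by
    by_contra hne
    exact hmin _ (filter_subset _ _) ⟨i₀, mem_filter.mpr ⟨hi₀, hcl₀⟩⟩ hne hvan
  intro i hi
  rw [← hT, mem_filter] at hi
  exact hi.2

omit [DecidableEq ι] in
/-- The common tail of both cases of Mann's argument: if all exponents are divisible by `p`, the
normalised roots already lie in `μ_{n/p}`, contradicting the minimality of `n`. -/
theorem mann_tail {n p n₁ : ℕ} {ζ : ℂ} (hζ : IsPrimitiveRoot ζ n) (hp : p.Prime)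
    (hnp : n = p * n₁) (hn₁ : 0 < n₁) (S : Finset ι) (w : ι → ℂ) (e : ι → ℕ)
    (he : ∀ i ∈ S, ζ ^ e i = w i)
    (hnmin : ∀ m < n, ¬(0 < m ∧ ∀ i ∈ S, w i ^ m = 1)) (hdiv : ∀ i ∈ S, p ∣ e i) : False := by
  refine hnmin n₁ ?_ ⟨hn₁, fun i hi => ?_⟩
  · calc n₁ = 1 * n₁ := (one_mul _).symm
      _ < p * n₁ := Nat.mul_lt_mul_of_pos_right hp.one_lt hn₁
      _ = n := hnp.symm
  · obtain ⟨k, hk⟩ := hdiv i hi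
    rw [← he i hi, hk, ← pow_mul, show p * k * n₁ = n * k by rw [hnp]; ring, pow_mul,
      hζ.pow_eq_one, one_pow]

/-- **Mann's argument, case `p² ∣ n`:** impossible. -/
theorem mann_not_sq_dvd {n p n₁ : ℕ} {ζ : ℂ} (hζ : IsPrimitiveRoot ζ n) (hn : 0 < n)
    (hp : p.Prime) (hnp : n = p * n₁) (hpn₁ : p ∣ n₁) (S : Finset ι) (ε : ι → ℚ) (w : ι → ℂ)
    (e : ι → ℕ) (he : ∀ i ∈ S, ζ ^ e i = w i) {i₀ : ι} (hi₀ : i₀ ∈ S) (he₀ : p ∣ e i₀)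
    (hsum : ∑ i ∈ S, (ε i : ℂ) * w i = 0)
    (hmin : ∀ T ⊆ S, T.Nonempty → T ≠ S → ∑ i ∈ T, (ε i : ℂ) * w i ≠ 0)
    (hnmin : ∀ m < n, ¬(0 < m ∧ ∀ i ∈ S, w i ^ m = 1)) : False := by
  have hn₁ : 0 < n₁ := Nat.pos_of_ne_zero fun h => by simp [hnp, h] at hn
  -- class sums
  set C : ℕ → ℂ := fun j => ∑ i ∈ S.filter (fun i => e i % p = j), (ε i : ℂ) * (ζ ^ p) ^ (e i / p)
    with hC
  have hclass : ∀ j, ∑ i ∈ S.filter (fun i => e i % p = j), (ε i : ℂ) * w i = ζ ^ j * C j := by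
    intro j
    rw [hC, mul_sum]
    refine sum_congr rfl fun i hi => ?_
    rw [mem_filter] at hi
    rw [← he i hi.1, ← hi.2, mul_left_comm, ← pow_mul, ← pow_add, Nat.mod_add_div]
  have hCsum : ∑ j ∈ range p, ζ ^ j * C j = 0 := by
    rw [← hsum, ← sum_fiberwise_of_maps_to (g := fun i => e i % p) (t := range p)
      (fun i _ => mem_range.mpr (Nat.mod_lt _ hp.pos))]
    exact sum_congr rfl fun j _ => (hclass j).symm
  have hCmem : ∀ j < p, C j ∈ ℚ⟮ζ ^ p⟯ := fun j _ =>
    sum_mem fun i _ => mul_mem (SubfieldClass.ratCast_mem _ _)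
      (pow_mem (mem_adjoin_simple_self ℚ (ζ ^ p)) _)
  have hC0 := sum_pow_mul_eq_zero_of_dvd hζ hn hp hnp hpn₁ C hCmem hCsum
  -- every class vanishes, hence there is only the class of `i₀`
  have hvan : ∑ i ∈ S.filter (fun i => e i % p = 0), (ε i : ℂ) * w i = 0 := by
    rw [hclass 0, hC0 0 hp.pos, mul_zero]
  have hall := filter_eq_self_of_minimal S (fun i => (ε i : ℂ) * w i) (fun i => e i % p) hmin hvan
    hi₀ (Nat.mod_eq_zero_of_dvd he₀)
  exact mann_tail hζ hp hnp hn₁ S w e he hnmin fun i hi => Nat.dvd_of_mod_eq_zero (hall i hi)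

/-- **Mann's argument, case `p ∥ n`:** then `p ≤ |S|`. -/
theorem mann_le_card {n p n₁ : ℕ} {ζ : ℂ} (hζ : IsPrimitiveRoot ζ n) (hn : 0 < n)
    (hp : p.Prime) (hnp : n = p * n₁) (hpn₁ : ¬p ∣ n₁) (S : Finset ι) (ε : ι → ℚ) (w : ι → ℂ)
    (e : ι → ℕ) (he : ∀ i ∈ S, ζ ^ e i = w i) {i₀ : ι} (hi₀ : i₀ ∈ S) (he₀ : p ∣ e i₀)
    (hsum : ∑ i ∈ S, (ε i : ℂ) * w i = 0)
    (hmin : ∀ T ⊆ S, T.Nonempty → T ≠ S → ∑ i ∈ T, (ε i : ℂ) * w i ≠ 0)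
    (hnmin : ∀ m < n, ¬(0 < m ∧ ∀ i ∈ S, w i ^ m = 1)) : p ≤ S.card := by
  by_contra hlt
  rw [not_le] at hlt
  have hn₁ : 0 < n₁ := Nat.pos_of_ne_zero fun h => by simp [hnp, h] at hn
  have hρ : IsPrimitiveRoot (ζ ^ n₁) p := by
    have := hζ.pow_of_dvd hn₁.ne' (hnp ▸ dvd_mul_left n₁ p)
    rwa [hnp, Nat.mul_div_cancel _ hn₁] at this
  obtain ⟨A, B, hA, hB⟩ := exists_inverse_exponents hp hpn₁ hn₁
  have hpB : ¬p ∣ B := by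
    intro h
    have h1 : B * n₁ ≡ 0 [MOD p] := Nat.modEq_zero_iff_dvd.mpr (dvd_mul_of_dvd_left h _)
    have h2 : 1 ≡ 0 [MOD p] := hB.symm.trans h1
    exact hp.one_lt.ne' (Nat.eq_one_of_dvd_one (Nat.modEq_zero_iff_dvd.mp h2))
  -- classes `cl i = (e i * B) % p`, class sums
  set cl : ι → ℕ := fun i => e i * B % p with hcl
  set C : ℕ → ℂ := fun j => ∑ i ∈ S.filter (fun i => cl i = j), (ε i : ℂ) * (ζ ^ p) ^ (e i * A)
    with hC
  have hclass : ∀ j, ∑ i ∈ S.filter (fun i => cl i = j), (ε i : ℂ) * w i = (ζ ^ n₁) ^ j * C j := by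
    intro j
    rw [hC, mul_sum]
    refine sum_congr rfl fun i hi => ?_
    rw [mem_filter] at hi
    have hw : w i = (ζ ^ n₁) ^ (cl i) * (ζ ^ p) ^ (e i * A) := by
      rw [← he i hi.1, pow_eq_rho_pow_mul_eta_pow hζ hp hnp hpn₁ hA hB (e i), hcl]
      congr 1
      conv_lhs => rw [← Nat.mod_add_div (e i * B) p, pow_add, pow_mul, hρ.pow_eq_one, one_pow,
        mul_one]
    rw [hw, ← hi.2, mul_left_comm]
  have hCsum : ∑ j ∈ range p, (ζ ^ n₁) ^ j * C j = 0 := by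
    rw [← hsum, ← sum_fiberwise_of_maps_to (g := cl) (t := range p)
      (fun i _ => mem_range.mpr (Nat.mod_lt _ hp.pos))]
    exact sum_congr rfl fun j _ => (hclass j).symm
  have hCmem : ∀ j < p, C j ∈ ℚ⟮ζ ^ p⟯ := fun j _ =>
    sum_mem fun i _ => mul_mem (SubfieldClass.ratCast_mem _ _)
      (pow_mem (mem_adjoin_simple_self ℚ (ζ ^ p)) _)
  have hCeq := sum_pow_mul_eq_zero_of_not_dvd hζ hn hp hnp hpn₁ C hCmem hCsum
  -- an empty class: `|S| < p`
  obtain ⟨j₀, hj₀, hj₀S⟩ : ∃ j₀ ∈ range p, j₀ ∉ S.image cl := by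
    apply exists_mem_notMem_of_card_lt_card
    exact lt_of_le_of_lt card_image_le (by simpa using hlt)
  have hCj₀ : C j₀ = 0 := by
    rw [hC]
    apply sum_eq_zero
    intro i hi
    rw [mem_filter] at hi
    exact absurd (mem_image.mpr ⟨i, hi.1, hi.2⟩) hj₀S
  have hC0 : ∀ j < p, C j = 0 := fun j hj => by
    rw [hCeq j hj, ← hCeq j₀ (mem_range.mp hj₀), hCj₀]
  have hvan : ∑ i ∈ S.filter (fun i => cl i = 0), (ε i : ℂ) * w i = 0 := by
    rw [hclass 0, hC0 0 hp.pos, mul_zero]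
  have hcl₀ : cl i₀ = 0 := Nat.mod_eq_zero_of_dvd (dvd_mul_of_dvd_left he₀ B)
  have hall := filter_eq_self_of_minimal S (fun i => (ε i : ℂ) * w i) cl hmin hvan hi₀ hcl₀
  refine mann_tail hζ hp hnp hn₁ S w e he hnmin fun i hi => ?_
  have h1 : p ∣ e i * B := Nat.dvd_of_mod_eq_zero (hall i hi)
  exact (Nat.Coprime.dvd_mul_right ((Nat.Prime.coprime_iff_not_dvd hp).mpr hpB)).mp h1

/-- **Mann's theorem** (Mann 1965, Thm 1). In a minimal vanishing `ℚ`-linear combination of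
complex roots of unity `∑_{i∈S} ε_i t_i = 0` (no nonempty proper subsum vanishes), every ratio
satisfies `(t_i / t_j) ^ primorial |S| = 1` (the hypothesis `ε_i ≠ 0` of the usual statement is
implied by minimality and not needed). -/
theorem mann (S : Finset ι) (ε : ι → ℚ) (t : ι → ℂ)
    (ht : ∀ i ∈ S, ∃ N : ℕ, 0 < N ∧ t i ^ N = 1) (hsum : ∑ i ∈ S, (ε i : ℂ) * t i = 0)
    (hmin : ∀ T ⊆ S, T.Nonempty → T ≠ S → ∑ i ∈ T, (ε i : ℂ) * t i ≠ 0) :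
    ∀ i ∈ S, ∀ j ∈ S, (t i / t j) ^ primorial S.card = 1 := by
  classical
  -- trivial if `S = ∅`; otherwise fix `i₀ ∈ S`
  rcases S.eq_empty_or_nonempty with hS | ⟨i₀, hi₀⟩
  · simp [hS]
  have ht0 : ∀ i ∈ S, t i ≠ 0 := by
    intro i hi h0
    obtain ⟨N, hN, hN1⟩ := ht i hi
    rw [h0, zero_pow hN.ne'] at hN1
    exact zero_ne_one hN1
  -- normalise
  set w : ι → ℂ := fun i => t i / t i₀ with hw
  have hw₀ : w i₀ = 1 := div_self (ht0 i₀ hi₀)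
  have hsum' : ∑ i ∈ S, (ε i : ℂ) * w i = 0 := by
    simp only [hw, ← mul_div_assoc, ← sum_div, hsum, zero_div]
  have hmin' : ∀ T ⊆ S, T.Nonempty → T ≠ S → ∑ i ∈ T, (ε i : ℂ) * w i ≠ 0 := by
    intro T hT hTne hTS h0
    apply hmin T hT hTne hTS
    simp only [hw, ← mul_div_assoc, ← sum_div] at h0
    rcases div_eq_zero_iff.mp h0 with h | h
    · exact h
    · exact absurd h (ht0 i₀ hi₀)
  -- the least common period `n` of the `w i`
  have hex : ∃ m : ℕ, 0 < m ∧ ∀ i ∈ S, w i ^ m = 1 := by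
    choose! N hN using ht
    refine ⟨∏ i ∈ S, N i, prod_pos fun i hi => (hN i hi).1, fun i hi => ?_⟩
    obtain ⟨k, hk⟩ := dvd_prod_of_mem N hi
    obtain ⟨k₀, hk₀⟩ := dvd_prod_of_mem N hi₀
    rw [hw]
    simp only [div_pow]
    rw [show (∏ i ∈ S, N i) = N i * k from hk, pow_mul, (hN i hi).2, one_pow, ← hk,
      hk₀, pow_mul, (hN i₀ hi₀).2, one_pow, div_one]
  set n := Nat.find hex with hn_def
  obtain ⟨hn, hwn⟩ : 0 < n ∧ ∀ i ∈ S, w i ^ n = 1 := Nat.find_spec hex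
  have hnmin : ∀ m < n, ¬(0 < m ∧ ∀ i ∈ S, w i ^ m = 1) := fun m hm => Nat.find_min hex hm
  -- it suffices that `n ∣ primorial |S|`
  suffices hdvd : n ∣ primorial S.card by
    intro i hi j hj
    obtain ⟨k, hk⟩ := hdvd
    have hij : t i / t j = w i / w j := by
      rw [hw]
      field_simp [ht0 i hi, ht0 j hj, ht0 i₀ hi₀]
    rw [hij, hk, pow_mul, div_pow, hwn i hi, hwn j hj, div_one, one_pow]
  -- exponents
  haveI : NeZero n := ⟨hn.ne'⟩
  set ζ : ℂ := Complex.exp (2 * Real.pi * Complex.I / n) with hζ_def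
  have hζ : IsPrimitiveRoot ζ n := Complex.isPrimitiveRoot_exp n hn.ne'
  have hex_e : ∀ i, ∃ k : ℕ, i ∈ S → ζ ^ k = w i := by
    intro i
    by_cases hi : i ∈ S
    · obtain ⟨k, -, hk⟩ := hζ.eq_pow_of_pow_eq_one (hwn i hi)
      exact ⟨k, fun _ => hk⟩
    · exact ⟨0, fun h => absurd h hi⟩
  choose e he using hex_e
  have he₀ : n ∣ e i₀ := (hζ.pow_eq_one_iff_dvd _).mp (by rw [he i₀ hi₀, hw₀])
  -- every prime factor of `n` is `≤ |S|` and occurs only once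
  have hprime : ∀ p : ℕ, p.Prime → p ∣ n → p ≤ S.card ∧ ¬p ∣ n / p := by
    intro p hp hpn
    obtain ⟨n₁, hnp⟩ := hpn
    have hn₁eq : n / p = n₁ := by rw [hnp, Nat.mul_div_cancel_left _ hp.pos]
    rw [hn₁eq]
    have hpe₀ : p ∣ e i₀ := (Dvd.intro _ hnp.symm).trans he₀
    constructor
    · by_cases hpn₁ : p ∣ n₁
      · exact (mann_not_sq_dvd hζ hn hp hnp hpn₁ S ε w e he hi₀ hpe₀ hsum' hmin' hnmin).elim
      · exact mann_le_card hζ hn hp hnp hpn₁ S ε w e he hi₀ hpe₀ hsum' hmin' hnmin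
    · intro hpn₁
      exact mann_not_sq_dvd hζ hn hp hnp hpn₁ S ε w e he hi₀ hpe₀ hsum' hmin' hnmin
  have hsq : Squarefree n := by
    rw [Nat.squarefree_iff_prime_squarefree]
    intro p hp hpp
    have hpn : p ∣ n := (dvd_mul_right p p).trans hpp
    apply (hprime p hp hpn).2
    obtain ⟨k, hk⟩ := hpp
    rw [hk, mul_assoc, Nat.mul_div_cancel_left _ hp.pos]
    exact dvd_mul_right p k
  rw [← Nat.prod_primeFactors_of_squarefree hsq, primorial]
  apply prod_dvd_prod_of_subset
  intro p hp
  have hp' := Nat.prime_of_mem_primeFactors hp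
  rw [mem_filter, mem_range]
  exact ⟨Nat.lt_succ_of_le (hprime p hp' (Nat.dvd_of_mem_primeFactors hp)).1, hp'⟩

end Mann

/-! ### The packaged consequence -/

/-- **Every term of a vanishing sum of roots of unity sits in a small rigid block.** If
`∑_{i∈S} ε_i t_i = 0` with all `ε_i ≠ 0` and all `t_i` roots of unity, then every `i ∈ S` lies in a
sub-block `B ⊆ S` with vanishing sum, containing some other index, all of whose ratios satisfy
`(t_j / t_k) ^ primorial |S| = 1`. -/
theorem exists_block_ratio_pow_primorial_eq_one {ι : Type*} [DecidableEq ι] (S : Finset ι)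
    (ε : ι → ℚ) (t : ι → ℂ) (hε : ∀ i ∈ S, ε i ≠ 0) (ht : ∀ i ∈ S, ∃ N : ℕ, 0 < N ∧ t i ^ N = 1)
    (hsum : ∑ i ∈ S, (ε i : ℂ) * t i = 0) {i : ι} (hi : i ∈ S) :
    ∃ B ⊆ S, i ∈ B ∧ ∑ k ∈ B, (ε k : ℂ) * t k = 0 ∧ (∃ j ∈ B, j ≠ i) ∧
      ∀ j ∈ B, ∀ k ∈ B, (t j / t k) ^ primorial S.card = 1 := by
  obtain ⟨B, hBS, hiB, hBsum, hBmin⟩ :=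
    exists_minimal_vanishing_block (fun k => (ε k : ℂ) * t k) S hsum hi
  have ht0 : ∀ k ∈ S, t k ≠ 0 := by
    intro k hk h0
    obtain ⟨N, hN, hN1⟩ := ht k hk
    rw [h0, zero_pow hN.ne'] at hN1
    exact zero_ne_one hN1
  refine ⟨B, hBS, hiB, hBsum, ?_, ?_⟩
  · by_contra hno
    have hno' : ∀ k ∈ B, k = i := fun k hk => by
      by_contra h
      exact hno ⟨k, hk, h⟩
    have hB1 : B = {i} := by
      ext k
      simp only [mem_singleton]
      exact ⟨fun hk => hno' k hk, fun hk => hk ▸ hiB⟩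
    rw [hB1, sum_singleton] at hBsum
    rcases mul_eq_zero.mp hBsum with h | h
    · exact hε i hi (by exact_mod_cast h)
    · exact ht0 i hi h
  · intro j hj k hk
    have h := mann B ε t (fun l hl => ht l (hBS hl)) hBsum hBmin j hj k hk
    obtain ⟨m, hm⟩ := primorial_dvd_primorial (card_le_card hBS)
    rw [hm, pow_mul, h, one_pow]

end Summit.HubbardSuperconductivity.HubbardSuperconductivity.Theorems.BcsKacWindow
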